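import Mathlib.Analysis.SpecificLimits.Basic
import Mathlib.Analysis.Normed.Group.Ultra
import Mathlib.Analysis.Normed.Field.Lemmas
import Mathlib.Analysis.Normed.Ring.Lemmas
import HarnessLib

/-!
# Lang's limit `λ(y) = lim ρ^{-m} [ρ]^m(y)`: the Lubin–Tate logarithm of `P = ρX + X^q` as a limit in a complete
# ultrametric field

Topic `Literature/NumberTheory/PAdicHodge`; elementary analysis in a complete non-archimedean normed field `K`
(used with `K = ℂ_F`). For the Lubin–Tate polynomial `P(z) = ρ z + z^q` (`0 < ‖ρ‖ < 1`, `q ≥ 2`) and a point `y`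
close to `0` (`‖y‖^{q-1} < ‖ρ‖`):

* §1 `ltMap ρ q = P`, its iterates `Pᵐ(y)` have norm `‖ρ‖ᵐ‖y‖` (`norm_ltMap_iterate`);
* §2 **Lang's sequence** `langSeq ρ q y m = Pᵐ(y)/ρᵐ` is Cauchy (consecutive differences `Pᵐ(y)^q/ρ^{m+1}`, geometric)
  and converges to **Lang's limit** `langLog ρ q y` (`tendsto_langSeq`) — Lang's `λ(X) = lim π^{-n} [πⁿ]_f(X)`
  (*Cyclotomic Fields* Ch. 8 §6 Lemma 1) evaluated at a point, i.e. the value `λ_P(y)` of the logarithm of the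
  Lubin–Tate group of `P` (Lemma 3 (ii) loc. cit.: `λ` converges on the maximal ideal);
* §3 `‖λ(y) − y‖ ≤ ‖y‖^q/‖ρ‖ < ‖y‖`, so `‖λ(y)‖ = ‖y‖` and **`λ(y) ≠ 0` for `y ≠ 0`** (Lemma 3 (iii) loc. cit.:
  `λ(x) ≡ x mod x²`);
* §4 **functoriality**: a continuous ring endomorphism `s` of `K` fixing `ρ` satisfies `s(λ(y)) = λ(s y)`
  (`map_langLog`), and **linearisation**: if two orbits satisfy `‖Pᵐ(w) − κ Pᵐ(y)‖ ≤ ‖Pᵐ(y)‖²` for all `m`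
  (e.g. `w = [a]_P(y)` with `[a]_P ≡ κX mod X²`) then `λ(w) = κ λ(y)` (`langLog_eq_mul`; Lemma 2 loc. cit.:
  `λ ∘ [a] = a λ`).

This is the analytic input of the conjugate-period construction for Lubin–Tate characters
(`LubinTateCharacterConjugatesTotallyRamified`): no power-series logarithm over `ℂ_F` is needed, only this limit.
No named facts, no `sorry`.

## References
* [LangCyclotomic1990] S. Lang, *Cyclotomic Fields I and II*, GTM 121 (1990), Ch. 8 §6, Lemma 1 (PDF p. 148),
  Lemma 2, Lemma 3 (PDF p. 149).
* [CasselsFrohlichANT1967] J.-P. Serre, *Local class field theory*, in Cassels–Fröhlich (1967), Ch. VI §3.3.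
-/

noncomputable section

open Filter
open _root_.Topology

namespace Literature.NumberTheory.PAdicHodge

namespace LangLimit

variable {K : Type*} [NormedField K] (ρ : K) (q : ℕ)

/-! ## §1 The Lubin–Tate map `P(z) = ρ z + z^q` and the norms of its iterates -/

/-- **`P(z) = ρ z + z^q`**, the Lubin–Tate polynomial of `ρ` as a self-map of `K`. [cite: LangCyclotomic1990, Ch. 8 §6 Lemma 1] -/
def ltMap (z : K) : K := ρ * z + z ^ q

/-- **Lang's sequence `Pᵐ(y)/ρᵐ`.** [cite: LangCyclotomic1990, Ch. 8 §6 Lemma 1] -/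
def langSeq (y : K) (m : ℕ) : K := (ltMap ρ q)^[m] y / ρ ^ m

/-- **Lang's limit `λ(y) = lim_m Pᵐ(y)/ρᵐ`** (the value at `y` of the logarithm of the Lubin–Tate group of `P`).
[cite: LangCyclotomic1990, Ch. 8 §6 Lemma 1] -/
def langLog (y : K) : K := limUnder atTop (langSeq ρ q y)

variable {ρ q}

/-- `P(0) = 0`. [cite: LangCyclotomic1990, Ch. 8 §6 Lemma 1] -/
theorem ltMap_zero (hq : q ≠ 0) : ltMap ρ q 0 = 0 := by
  simp [ltMap, zero_pow hq]

/-- `langSeq y 0 = y`. [cite: LangCyclotomic1990, Ch. 8 §6 Lemma 1] -/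
@[simp] theorem langSeq_zero (y : K) : langSeq ρ q y 0 = y := by
  simp [langSeq]

/-- A ring endomorphism fixing `ρ` commutes with the iterates of `P`. [cite: LangCyclotomic1990, Ch. 8 §6 Lemma 2] -/
theorem map_ltMap_iterate (s : K →+* K) (hs : s ρ = ρ) (y : K) (m : ℕ) :
    s ((ltMap ρ q)^[m] y) = (ltMap ρ q)^[m] (s y) := by
  induction m with
  | zero => rfl
  | succ m ih =>
    rw [Function.iterate_succ_apply', Function.iterate_succ_apply', ← ih, ltMap, ltMap, map_add, map_mul, map_pow, hs]

/-- A ring endomorphism fixing `ρ` commutes with Lang's sequence. [cite: LangCyclotomic1990, Ch. 8 §6 Lemma 2] -/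
theorem map_langSeq (s : K →+* K) (hs : s ρ = ρ) (y : K) (m : ℕ) :
    s (langSeq ρ q y m) = langSeq ρ q (s y) m := by
  rw [langSeq, langSeq, map_div₀, map_pow, hs, map_ltMap_iterate s hs]

/-- `P^{m+1}(y)/ρ^{m+1} − Pᵐ(y)/ρᵐ = Pᵐ(y)^q/ρ^{m+1}`. [cite: LangCyclotomic1990, Ch. 8 §6 Lemma 1] -/
theorem langSeq_succ_sub (hρ : ρ ≠ 0) (y : K) (m : ℕ) :
    langSeq ρ q y (m + 1) - langSeq ρ q y m = ((ltMap ρ q)^[m] y) ^ q / ρ ^ (m + 1) := by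
  simp only [langSeq, Function.iterate_succ_apply', ltMap]
  have hρm : ρ ^ (m + 1) ≠ 0 := pow_ne_zero _ hρ
  have hρm' : ρ ^ m ≠ 0 := pow_ne_zero _ hρ
  field_simp
  ring

variable [IsUltrametricDist K]

/-- **`‖P(z)‖ = ‖ρ‖‖z‖` for `‖z‖^{q-1} < ‖ρ‖`** (the term `ρ z` dominates). [cite: LangCyclotomic1990, Ch. 8 §6 Lemma 3] -/
theorem norm_ltMap (hq : 2 ≤ q) {z : K} (hz : ‖z‖ ^ (q - 1) < ‖ρ‖) : ‖ltMap ρ q z‖ = ‖ρ‖ * ‖z‖ := by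
  by_cases h0 : z = 0
  · subst h0; rw [ltMap_zero (by omega), norm_zero, mul_zero]
  have hzpos : 0 < ‖z‖ := norm_pos_iff.2 h0
  have hlt : ‖z ^ q‖ < ‖ρ * z‖ := by
    rw [norm_pow, norm_mul, ← pow_sub_one_mul (by omega : q ≠ 0) ‖z‖]
    exact mul_lt_mul_of_pos_right hz hzpos
  rw [ltMap, IsUltrametricDist.norm_add_eq_max_of_norm_ne_norm (ne_of_gt hlt), max_eq_left hlt.le, norm_mul]

/-- **`‖Pᵐ(y)‖ = ‖ρ‖ᵐ‖y‖` for `‖y‖^{q-1} < ‖ρ‖ ≤ 1`.** [cite: LangCyclotomic1990, Ch. 8 §6 Lemma 3] -/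
theorem norm_ltMap_iterate (hq : 2 ≤ q) (hρ : ‖ρ‖ ≤ 1) {y : K} (hy : ‖y‖ ^ (q - 1) < ‖ρ‖) (m : ℕ) :
    ‖(ltMap ρ q)^[m] y‖ = ‖ρ‖ ^ m * ‖y‖ := by
  induction m with
  | zero => simp
  | succ m ih =>
    have hzm : ‖(ltMap ρ q)^[m] y‖ ≤ ‖y‖ := by
      rw [ih]; exact mul_le_of_le_one_left (norm_nonneg _) (pow_le_one₀ (norm_nonneg _) hρ)
    have hzm' : ‖(ltMap ρ q)^[m] y‖ ^ (q - 1) < ‖ρ‖ :=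
      lt_of_le_of_lt (pow_le_pow_left₀ (norm_nonneg _) hzm _) hy
    rw [Function.iterate_succ_apply', norm_ltMap hq hzm', ih, pow_succ]; ring

/-! ## §2 Convergence of Lang's sequence -/

/-- `‖P^{m+1}(y)/ρ^{m+1} − Pᵐ(y)/ρᵐ‖ ≤ (‖y‖^q/‖ρ‖)·(‖ρ‖^{q-1})ᵐ`: the differences decay geometrically.
[cite: LangCyclotomic1990, Ch. 8 §6 Lemma 1] -/
theorem norm_langSeq_succ_sub_le (hq : 2 ≤ q) (hρ0 : ρ ≠ 0) (hρ : ‖ρ‖ ≤ 1) {y : K} (hy : ‖y‖ ^ (q - 1) < ‖ρ‖) (m : ℕ) :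
    ‖langSeq ρ q y (m + 1) - langSeq ρ q y m‖ ≤ ‖y‖ ^ q / ‖ρ‖ * (‖ρ‖ ^ (q - 1)) ^ m := by
  have hρpos : 0 < ‖ρ‖ := norm_pos_iff.2 hρ0
  rw [langSeq_succ_sub hρ0, norm_div, norm_pow, norm_pow, norm_ltMap_iterate hq hρ hy, mul_pow, ← pow_mul]
  apply le_of_eq
  obtain ⟨r, rfl⟩ : ∃ r, q = r + 1 := ⟨q - 1, by omega⟩
  rw [Nat.add_sub_cancel]
  field_simp
  ring

/-- **Lang's sequence is Cauchy.** [cite: LangCyclotomic1990, Ch. 8 §6 Lemma 1] -/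
theorem cauchySeq_langSeq (hq : 2 ≤ q) (hρ0 : ρ ≠ 0) (hρ1 : ‖ρ‖ < 1) {y : K} (hy : ‖y‖ ^ (q - 1) < ‖ρ‖) :
    CauchySeq (langSeq ρ q y) := by
  have hθ : ‖ρ‖ ^ (q - 1) < 1 := pow_lt_one₀ (norm_nonneg _) hρ1 (by omega)
  refine cauchySeq_of_le_geometric (‖ρ‖ ^ (q - 1)) (‖y‖ ^ q / ‖ρ‖) hθ fun m => ?_
  rw [dist_comm, dist_eq_norm]
  exact norm_langSeq_succ_sub_le hq hρ0 hρ1.le hy m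

/-- **Lang's limit exists**: `Pᵐ(y)/ρᵐ → λ(y)`. [cite: LangCyclotomic1990, Ch. 8 §6 Lemma 1] -/
theorem tendsto_langSeq [CompleteSpace K] (hq : 2 ≤ q) (hρ0 : ρ ≠ 0) (hρ1 : ‖ρ‖ < 1) {y : K}
    (hy : ‖y‖ ^ (q - 1) < ‖ρ‖) : Tendsto (langSeq ρ q y) atTop (𝓝 (langLog ρ q y)) :=
  (cauchySeq_langSeq hq hρ0 hρ1 hy).tendsto_limUnder

/-! ## §3 `λ(y) ≡ y`: the limit is as large as `y`, in particular non-zero -/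

/-- `‖Pᵐ(y)/ρᵐ − y‖ ≤ ‖y‖^q/‖ρ‖` for every `m`. [cite: LangCyclotomic1990, Ch. 8 §6 Lemma 3 (iii)] -/
theorem norm_langSeq_sub_le (hq : 2 ≤ q) (hρ0 : ρ ≠ 0) (hρ1 : ‖ρ‖ < 1) {y : K} (hy : ‖y‖ ^ (q - 1) < ‖ρ‖) (m : ℕ) :
    ‖langSeq ρ q y m - y‖ ≤ ‖y‖ ^ q / ‖ρ‖ := by
  have hθ : ‖ρ‖ ^ (q - 1) < 1 := pow_lt_one₀ (norm_nonneg _) hρ1 (by omega)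
  induction m with
  | zero => rw [langSeq_zero, sub_self, norm_zero]; positivity
  | succ m ih =>
    have h : langSeq ρ q y (m + 1) - y = (langSeq ρ q y (m + 1) - langSeq ρ q y m) + (langSeq ρ q y m - y) := by ring
    rw [h]
    refine (IsUltrametricDist.norm_add_le_max _ _).trans (max_le ?_ ih)
    refine (norm_langSeq_succ_sub_le hq hρ0 hρ1.le hy m).trans ?_
    exact mul_le_of_le_one_right (by positivity) (pow_le_one₀ (by positivity) hθ.le)

/-- **`‖λ(y) − y‖ ≤ ‖y‖^q/‖ρ‖`.** [cite: LangCyclotomic1990, Ch. 8 §6 Lemma 3 (iii)] -/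
theorem norm_langLog_sub_le [CompleteSpace K] (hq : 2 ≤ q) (hρ0 : ρ ≠ 0) (hρ1 : ‖ρ‖ < 1) {y : K}
    (hy : ‖y‖ ^ (q - 1) < ‖ρ‖) : ‖langLog ρ q y - y‖ ≤ ‖y‖ ^ q / ‖ρ‖ :=
  le_of_tendsto' (((tendsto_langSeq hq hρ0 hρ1 hy).sub_const y).norm) (norm_langSeq_sub_le hq hρ0 hρ1 hy)

omit [IsUltrametricDist K] in
/-- `‖y‖^q/‖ρ‖ < ‖y‖` in the regime `‖y‖^{q-1} < ‖ρ‖`, `y ≠ 0`. [cite: LangCyclotomic1990, Ch. 8 §6 Lemma 3 (iii)] -/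
theorem pow_div_lt_norm (hq : 2 ≤ q) (hρ0 : ρ ≠ 0) {y : K} (hy : ‖y‖ ^ (q - 1) < ‖ρ‖) (hy0 : y ≠ 0) :
    ‖y‖ ^ q / ‖ρ‖ < ‖y‖ := by
  have hρpos : 0 < ‖ρ‖ := norm_pos_iff.2 hρ0
  have hypos : 0 < ‖y‖ := norm_pos_iff.2 hy0
  rw [div_lt_iff₀ hρpos, ← pow_sub_one_mul (by omega : q ≠ 0) ‖y‖, mul_comm ‖y‖]
  exact mul_lt_mul_of_pos_right hy hypos

/-- **`‖λ(y)‖ = ‖y‖`.** [cite: LangCyclotomic1990, Ch. 8 §6 Lemma 3 (iii)] -/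
theorem norm_langLog [CompleteSpace K] (hq : 2 ≤ q) (hρ0 : ρ ≠ 0) (hρ1 : ‖ρ‖ < 1) {y : K}
    (hy : ‖y‖ ^ (q - 1) < ‖ρ‖) : ‖langLog ρ q y‖ = ‖y‖ := by
  by_cases hy0 : y = 0
  · subst hy0
    have h := norm_langLog_sub_le hq hρ0 hρ1 hy
    rw [norm_zero, zero_pow (by omega), zero_div, sub_zero] at h
    rw [norm_zero]; exact le_antisymm h (norm_nonneg _)
  have hlt : ‖langLog ρ q y - y‖ < ‖y‖ :=
    (norm_langLog_sub_le hq hρ0 hρ1 hy).trans_lt (pow_div_lt_norm hq hρ0 hy hy0)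
  have h : langLog ρ q y = (langLog ρ q y - y) + y := by ring
  rw [h, IsUltrametricDist.norm_add_eq_max_of_norm_ne_norm (ne_of_lt hlt), max_eq_right hlt.le]

/-- **`λ(y) ≠ 0` for `y ≠ 0`** (in the regime `‖y‖^{q-1} < ‖ρ‖`). [cite: LangCyclotomic1990, Ch. 8 §6 Lemma 3 (iii)] -/
theorem langLog_ne_zero [CompleteSpace K] (hq : 2 ≤ q) (hρ0 : ρ ≠ 0) (hρ1 : ‖ρ‖ < 1) {y : K}
    (hy : ‖y‖ ^ (q - 1) < ‖ρ‖) (hy0 : y ≠ 0) : langLog ρ q y ≠ 0 := by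
  rw [← norm_pos_iff, norm_langLog hq hρ0 hρ1 hy, norm_pos_iff]; exact hy0

/-! ## §4 Functoriality and linearisation -/

/-- **`s(λ(y)) = λ(s(y))`** for a continuous ring endomorphism `s` of `K` fixing `ρ` and preserving `‖y‖`
(e.g. `s ∈ Γ_F` acting on `ℂ_F`, `ρ ∈ F̄` fixed by `s`). [cite: LangCyclotomic1990, Ch. 8 §6 Lemma 2] -/
theorem map_langLog [CompleteSpace K] (hq : 2 ≤ q) (hρ0 : ρ ≠ 0) (hρ1 : ‖ρ‖ < 1) {y : K}
    (hy : ‖y‖ ^ (q - 1) < ‖ρ‖) (s : K →+* K) (hs : Continuous s) (hsρ : s ρ = ρ) (hsy : ‖s y‖ = ‖y‖) :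
    s (langLog ρ q y) = langLog ρ q (s y) := by
  have h1 : Tendsto (fun m => s (langSeq ρ q y m)) atTop (𝓝 (s (langLog ρ q y))) :=
    (hs.tendsto _).comp (tendsto_langSeq hq hρ0 hρ1 hy)
  have h2 : Tendsto (fun m => s (langSeq ρ q y m)) atTop (𝓝 (langLog ρ q (s y))) := by
    simp_rw [map_langSeq s hsρ]
    exact tendsto_langSeq hq hρ0 hρ1 (by rwa [hsy])
  exact tendsto_nhds_unique h1 h2

/-- **Linearisation `λ(w) = κ·λ(y)`**: if the `P`-orbits of `w` and `y` satisfy `‖Pᵐ(w) − κPᵐ(y)‖ ≤ ‖Pᵐ(y)‖²`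
(`‖κ‖ ≤ 1`; this holds for `w = [a]_P(y)`, `κ = a`, since `[a]_P ≡ aX mod X²` commutes with `P`), then Lang's
limits satisfy `λ(w) = κ λ(y)`. [cite: LangCyclotomic1990, Ch. 8 §6 Lemma 2] -/
theorem langLog_eq_mul [CompleteSpace K] (hq : 2 ≤ q) (hρ0 : ρ ≠ 0) (hρ1 : ‖ρ‖ < 1) {y w κ : K}
    (hy : ‖y‖ ^ (q - 1) < ‖ρ‖) (hκ : ‖κ‖ ≤ 1)
    (h : ∀ m, ‖(ltMap ρ q)^[m] w - κ * (ltMap ρ q)^[m] y‖ ≤ ‖(ltMap ρ q)^[m] y‖ ^ 2) :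
    langLog ρ q w = κ * langLog ρ q y := by
  have hρpos : 0 < ‖ρ‖ := norm_pos_iff.2 hρ0
  -- `‖y‖ < 1` and `‖w‖ ≤ ‖y‖`, so `w` is in the regime too
  have hy1 : ‖y‖ < 1 := by
    by_contra hge
    rw [not_lt] at hge
    exact absurd ((one_le_pow₀ hge).trans_lt (hy.trans hρ1)) (lt_irrefl _)
  have hwy : ‖w‖ ≤ ‖y‖ := by
    have h0 := h 0
    simp only [Function.iterate_zero, id_eq] at h0
    have hw : w = (w - κ * y) + κ * y := by ring
    rw [hw]
    refine (IsUltrametricDist.norm_add_le_max _ _).trans (max_le (h0.trans ?_) ?_)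
    · rw [sq]; exact mul_le_of_le_one_left (norm_nonneg _) hy1.le
    · rw [norm_mul]; exact mul_le_of_le_one_left (norm_nonneg _) hκ
  have hw : ‖w‖ ^ (q - 1) < ‖ρ‖ := lt_of_le_of_lt (pow_le_pow_left₀ (norm_nonneg _) hwy _) hy
  -- the difference of Lang's sequences tends to `λ(w) − κλ(y)` and to `0`
  have h1 : Tendsto (fun m => langSeq ρ q w m - κ * langSeq ρ q y m) atTop
      (𝓝 (langLog ρ q w - κ * langLog ρ q y)) :=
    (tendsto_langSeq hq hρ0 hρ1 hw).sub ((tendsto_langSeq hq hρ0 hρ1 hy).const_mul κ)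
  have hb : ∀ m, ‖langSeq ρ q w m - κ * langSeq ρ q y m‖ ≤ ‖y‖ ^ 2 * ‖ρ‖ ^ m := fun m => by
    have hρm : 0 < ‖ρ‖ ^ m := pow_pos hρpos m
    rw [langSeq, langSeq, mul_div_assoc', ← sub_div, norm_div, norm_pow, div_le_iff₀ hρm]
    calc ‖(ltMap ρ q)^[m] w - κ * (ltMap ρ q)^[m] y‖ ≤ ‖(ltMap ρ q)^[m] y‖ ^ 2 := h m
      _ = ‖y‖ ^ 2 * ‖ρ‖ ^ m * ‖ρ‖ ^ m := by rw [norm_ltMap_iterate hq hρ1.le hy]; ring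
  have h2 : Tendsto (fun m => langSeq ρ q w m - κ * langSeq ρ q y m) atTop (𝓝 0) := by
    refine squeeze_zero_norm hb ?_
    rw [← mul_zero (‖y‖ ^ 2)]
    exact (tendsto_pow_atTop_nhds_zero_of_lt_one (norm_nonneg _) hρ1).const_mul _
  exact sub_eq_zero.1 (tendsto_nhds_unique h1 h2)

end LangLimit

end Literature.NumberTheory.PAdicHodge

end
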